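import Mathlib
import Literature.Analysis.FluidPDE.Tao2016AveragedNS.SelfSimilarCascadeBlowup
import Literature.Analysis.FluidPDE.Tao2016AveragedNS.WeightedLatticeFlows
import Literature.Analysis.FluidPDE.Tao2016AveragedNS.ViscousLatticeUniqueness
import Literature.Analysis.FluidPDE.Tao2016AveragedNS.ViscousEnvelopeSmoothing
import Summits.NavierStokesRegularity.NavierStokesRegularity.Theorems.WakeRatchetMinimalViscousBlowupMaximalBlowup
import HarnessLib

/-!
# UNIQUENESS of the maximal exact cascade flow and CANONICITY of its blow-up time `T⋆` — so that the
  existential statements of the K2(1) kit (`maximalExactFlow_of_noGlobalCascade`,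
  `criticalBlowup_of_noGlobalCascade`, `criticalRate_of_noGlobalCascade`, `highShellBlowup_of_noGlobalCascade`,
  `energy_hasSum_of_noGlobalCascade`, `blowupProfile_of_noGlobalCascade`) all speak about THE SAME trajectory
  (support for stmt-NavierStokesRegularity-20206 `TaoLadderRungTwoBreak.BlowupRigidityOne`)

MODEL lattice ODEs only (Tao 2016 §4 (4.12)); nothing here is a statement about the Navier–Stokes equations;
NO item is closed (`--supports stmt-NavierStokesRegularity-20206`). Route-independent; general `m`; `ν ≥ 0`.

* `maximalFlow_unique` — let `(T, X)` be a maximal `ν`-viscous flow in the sense of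
  `maximalBlowup_of_nonneg_viscosity` (`C¹` on `[0,T)`, datum, exact/viscous motion on `[0,T)`,
  (4.5)-regular on every `[0,T']`, `T' < T`, (4.5) norm UNBOUNDED on `[0,T)`), and let `Y` be ANY solution
  of the same lattice from the same datum on a closed window `[0,T']` (derivatives within `[0,T']`) with a
  finite (4.5) bound there. Then `T' < T` and `Y = X` on `[0,T']` (uniqueness of regular flows,
  `viscousFlow_unique`, in the a priori weight `(1+ε₀)^{10k⁺}`). In particular two maximal flows have the
  same blow-up time and coincide before it (`maximalFlow_blowupTime_unique`).
-/

noncomputable section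

-- the summit and its single sub-problem share the name (CONVENTIONS §1)
set_option linter.dupNamespace false

open Set Filter Topology

namespace Summit.NavierStokesRegularity.NavierStokesRegularity.Theorems

namespace BlowupRigidityOne

open Literature.Analysis.FluidPDE Literature.Analysis.FluidPDE.TaoCascade
open MinimalViscousBlowup.ThresholdRay (aprioriWeight_le_weight45 hasDerivWithinAt_Ici_of_Icc)

variable {m : ℕ}

/-- **UNIQUENESS OF THE MAXIMAL FLOW / CANONICITY OF THE BLOW-UP TIME.** Structure constants of the class
`E₂(R)`, `ε₀ > 0`, `ν ≥ 0`. Let `X` be a flow of the `ν`-viscous lattice on `[0,T)` from the one-shell datum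
`X₀` (`C¹` on `[0,T)`, motion `derivWithin (X i n) [0,∞) t = quadTerm_{i,n}(X)(t) - ν(1+ε₀)^{2n}X_{i,n}(t)`),
(4.5)-regular on every `[0,T']`, `T' < T`, with (4.5) norm UNBOUNDED on `[0,T)`; and let `Y` solve the
same lattice from the same datum on `[0,T']`, `T' > 0` (derivatives within `[0,T']`), with a finite (4.5)
bound on `[0,T']`. Then `T' < T` and `Y = X` on `[0,T']`.
[cite: Tao2016AveragedNS, §4 Lemma 4.1 (4.5), (4.12); Teschl2012, Thm. 2.2 (uniqueness), §2.6] -/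
theorem maximalFlow_unique {ε₀ R ν T T' : ℝ} (hε : 0 < ε₀) (hν : 0 ≤ ν)
    {α : Fin m → Fin m → Fin m → ℤ × ℤ × ℤ → ℝ} (hα : InTableClass R α) {X₀ : Fin m → ℝ}
    {X Y : Fin m → ℤ → ℝ → ℝ}
    (hC1 : ∀ i n, ContDiffOn ℝ 1 (X i n) (Set.Ico 0 T))
    (hX0 : ∀ i n, X i n 0 = if n = 0 then X₀ i else 0)
    (hmot : ∀ i n t, 0 ≤ t → t < T → derivWithin (X i n) (Set.Ici 0) t =
      quadTerm ε₀ α X i n t - ν * (1 + ε₀) ^ ((2 : ℝ) * n) * X i n t)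
    (hreg : ∀ T'' : ℝ, 0 < T'' → T'' < T → ∃ M : ℝ, ∀ t : ℝ, 0 ≤ t → t ≤ T'' →
      ∀ (i : Fin m) (n : ℤ), (1 + (1 + ε₀) ^ ((10 : ℝ) * n)) * |X i n t| ≤ M)
    (hunb : ∀ M : ℝ, ∃ t : ℝ, 0 ≤ t ∧ t < T ∧
      ∃ (i : Fin m) (n : ℤ), M < (1 + (1 + ε₀) ^ ((10 : ℝ) * n)) * |X i n t|)
    (hT' : 0 < T') (hY0 : ∀ i n, Y i n 0 = if n = 0 then X₀ i else 0)
    (hYd : ∀ i n, ∀ t ∈ Icc 0 T', HasDerivWithinAt (Y i n)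
      (quadTerm ε₀ α Y i n t - ν * (1 + ε₀) ^ ((2 : ℝ) * n) * Y i n t) (Icc 0 T') t)
    (hYb : ∃ M : ℝ, ∀ t ∈ Icc 0 T', ∀ (i : Fin m) (n : ℤ), (1 + (1 + ε₀) ^ ((10 : ℝ) * n)) * |Y i n t| ≤ M) :
    T' < T ∧ ∀ t ∈ Icc 0 T', ∀ (i : Fin m) (n : ℤ), Y i n t = X i n t := by
  have hε0 : 0 ≤ ε₀ := hε.le
  have hl0 : (0 : ℝ) < 1 + ε₀ := by linarith
  set w : ℤ → ℝ := fun k => (1 + ε₀) ^ ((10 : ℝ) * ((max k 0 : ℤ) : ℝ)) with hw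
  have hW := weightRatiosLE_aprioriWeight hε0
  have hH3 : ∀ k : ℤ, w k ≤ 1 + (1 + ε₀) ^ ((10 : ℝ) * k) := fun k => aprioriWeight_le_weight45 hε0 k
  set α' := restrictShiftSet α with hα'def
  have hα' : ∀ i₁ i₂ i₃ μ, |α' i₁ i₂ i₃ μ| ≤ 1 :=
    abs_restrictShiftSet_le zero_le_one (abs_le_one_of_inTableClass hα)
  obtain ⟨MY, hMY⟩ := hYb
  -- uniqueness on every window `[0,s]` with `0 < s`, `s ≤ T'`, `s < T`
  have huniq : ∀ s : ℝ, 0 < s → s ≤ T' → s < T → ∀ t ∈ Icc 0 s, ∀ (i : Fin m) (n : ℤ),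
      Y i n t = X i n t := by
    intro s hs0 hsT' hsT
    obtain ⟨MX, hMX⟩ := hreg s hs0 hsT
    -- derivatives of `X` within `[0,s]`
    have hXd : ∀ i n, ∀ t ∈ Icc (0 : ℝ) s, HasDerivWithinAt (X i n)
        (quadTerm ε₀ α' X i n t - ν * (1 + ε₀) ^ ((2 : ℝ) * n) * X i n t) (Icc 0 s) t := by
      intro i n t ht
      have htT : t ∈ Ico (0 : ℝ) T := ⟨ht.1, lt_of_le_of_lt ht.2 hsT⟩
      have hd : DifferentiableWithinAt ℝ (X i n) (Ico 0 T) t :=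
        ((hC1 i n).differentiableOn one_ne_zero) t htT
      have hd' : DifferentiableWithinAt ℝ (X i n) (Ici 0) t :=
        hd.mono_of_mem_nhdsWithin (by
          rw [mem_nhdsWithin]
          exact ⟨Iio T, isOpen_Iio, htT.2, fun x hx => ⟨hx.2, hx.1⟩⟩)
      have h := hd'.hasDerivWithinAt
      rw [hmot i n t ht.1 htT.2, ← quadTerm_restrictShiftSet] at h
      exact h.mono Icc_subset_Ici_self
    have hYd' : ∀ i n, ∀ t ∈ Icc (0 : ℝ) s, HasDerivWithinAt (Y i n)
        (quadTerm ε₀ α' Y i n t - ν * (1 + ε₀) ^ ((2 : ℝ) * n) * Y i n t) (Icc 0 s) t := by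
      intro i n t ht
      have h := (hYd i n t ⟨ht.1, ht.2.trans hsT'⟩).mono (Icc_subset_Icc_right hsT')
      rwa [← quadTerm_restrictShiftSet] at h
    have key := viscousFlow_unique hl0.le hW zero_le_one hα' hν (B := max MX MY) (s := s)
      (X := Y) (Y := X) (fun i k => by rw [hY0, hX0])
      (fun t ht i k => le_trans ((mul_le_mul_of_nonneg_right (hH3 k) (abs_nonneg _)).trans
        (hMY t ⟨ht.1, ht.2.trans hsT'⟩ i k)) (le_max_right _ _))
      (fun t ht i k => le_trans ((mul_le_mul_of_nonneg_right (hH3 k) (abs_nonneg _)).trans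
        (hMX t ht.1 ht.2 i k)) (le_max_left _ _))
      hYd' hXd
    exact key
  -- `T' < T`: otherwise `X` is bounded by `MY` on `[0,T)`
  have hlt : T' < T := by
    by_contra hle
    have hle : T ≤ T' := not_lt.1 hle
    obtain ⟨t, ht0, htT, i, n, hbig⟩ := hunb MY
    -- a window `[0,s]` with `t ≤ s < T`, `0 < s`
    set s : ℝ := (t + T) / 2 with hsdef
    have hs0 : 0 < s := by rw [hsdef]; linarith
    have hsT : s < T := by rw [hsdef]; linarith
    have hts : t ≤ s := by rw [hsdef]; linarith
    have heq := huniq s hs0 (hsT.le.trans hle) hsT t ⟨ht0, hts⟩ i n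
    have hb := hMY t ⟨ht0, hts.trans (hsT.le.trans hle)⟩ i n
    rw [heq] at hb
    exact absurd hb (not_le.2 hbig)
  exact ⟨hlt, huniq T' hT' le_rfl hlt⟩

/-- **Two maximal flows coincide**: if `(T₁, X₁)` and `(T₂, X₂)` are both maximal `ν`-viscous flows from the
same one-shell datum (clauses of `maximalBlowup_of_nonneg_viscosity`), then `T₁ = T₂` and `X₁ = X₂` on
`[0,T₁)`. So the blow-up time `T⋆(ε₀, α, ν, X₀)` of the kit is CANONICAL.
[cite: Tao2016AveragedNS, §4 Lemma 4.1 (4.5), (4.12); Teschl2012, Thm. 2.2, §2.6] -/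
theorem maximalFlow_blowupTime_unique {ε₀ R ν T₁ T₂ : ℝ} (hε : 0 < ε₀) (hν : 0 ≤ ν)
    {α : Fin m → Fin m → Fin m → ℤ × ℤ × ℤ → ℝ} (hα : InTableClass R α) {X₀ : Fin m → ℝ}
    {X₁ X₂ : Fin m → ℤ → ℝ → ℝ}
    (h₁C : ∀ i n, ContDiffOn ℝ 1 (X₁ i n) (Set.Ico 0 T₁))
    (h₁0 : ∀ i n, X₁ i n 0 = if n = 0 then X₀ i else 0)
    (h₁m : ∀ i n t, 0 ≤ t → t < T₁ → derivWithin (X₁ i n) (Set.Ici 0) t =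
      quadTerm ε₀ α X₁ i n t - ν * (1 + ε₀) ^ ((2 : ℝ) * n) * X₁ i n t)
    (h₁r : ∀ T' : ℝ, 0 < T' → T' < T₁ → ∃ M : ℝ, ∀ t : ℝ, 0 ≤ t → t ≤ T' →
      ∀ (i : Fin m) (n : ℤ), (1 + (1 + ε₀) ^ ((10 : ℝ) * n)) * |X₁ i n t| ≤ M)
    (h₁u : ∀ M : ℝ, ∃ t : ℝ, 0 ≤ t ∧ t < T₁ ∧
      ∃ (i : Fin m) (n : ℤ), M < (1 + (1 + ε₀) ^ ((10 : ℝ) * n)) * |X₁ i n t|)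
    (h₂C : ∀ i n, ContDiffOn ℝ 1 (X₂ i n) (Set.Ico 0 T₂))
    (h₂0 : ∀ i n, X₂ i n 0 = if n = 0 then X₀ i else 0)
    (h₂m : ∀ i n t, 0 ≤ t → t < T₂ → derivWithin (X₂ i n) (Set.Ici 0) t =
      quadTerm ε₀ α X₂ i n t - ν * (1 + ε₀) ^ ((2 : ℝ) * n) * X₂ i n t)
    (h₂r : ∀ T' : ℝ, 0 < T' → T' < T₂ → ∃ M : ℝ, ∀ t : ℝ, 0 ≤ t → t ≤ T' →
      ∀ (i : Fin m) (n : ℤ), (1 + (1 + ε₀) ^ ((10 : ℝ) * n)) * |X₂ i n t| ≤ M)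
    (h₂u : ∀ M : ℝ, ∃ t : ℝ, 0 ≤ t ∧ t < T₂ ∧
      ∃ (i : Fin m) (n : ℤ), M < (1 + (1 + ε₀) ^ ((10 : ℝ) * n)) * |X₂ i n t|) :
    T₁ = T₂ ∧ ∀ t : ℝ, 0 ≤ t → t < T₁ → ∀ (i : Fin m) (n : ℤ), X₁ i n t = X₂ i n t := by
  -- restriction of a maximal flow to a closed window `[0,T']`, `0 < T' < T`, is a bounded regular solution
  have hwin : ∀ {T : ℝ} {X : Fin m → ℤ → ℝ → ℝ},
      (∀ i n, ContDiffOn ℝ 1 (X i n) (Set.Ico 0 T)) →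
      (∀ i n t, 0 ≤ t → t < T → derivWithin (X i n) (Set.Ici 0) t =
        quadTerm ε₀ α X i n t - ν * (1 + ε₀) ^ ((2 : ℝ) * n) * X i n t) →
      ∀ T' : ℝ, T' < T → ∀ i n, ∀ t ∈ Icc (0 : ℝ) T', HasDerivWithinAt (X i n)
        (quadTerm ε₀ α X i n t - ν * (1 + ε₀) ^ ((2 : ℝ) * n) * X i n t) (Icc 0 T') t := by
    intro T X hC hm T' hT' i n t ht
    have htT : t ∈ Ico (0 : ℝ) T := ⟨ht.1, lt_of_le_of_lt ht.2 hT'⟩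
    have hd : DifferentiableWithinAt ℝ (X i n) (Ico 0 T) t :=
      ((hC i n).differentiableOn one_ne_zero) t htT
    have hd' : DifferentiableWithinAt ℝ (X i n) (Ici 0) t :=
      hd.mono_of_mem_nhdsWithin (by
        rw [mem_nhdsWithin]
        exact ⟨Iio T, isOpen_Iio, htT.2, fun x hx => ⟨hx.2, hx.1⟩⟩)
    have h := hd'.hasDerivWithinAt
    rw [hm i n t ht.1 htT.2] at h
    exact h.mono Icc_subset_Ici_self
  -- `T₁ ≤ T₂` and `T₂ ≤ T₁` by symmetry: every `T' < T₂` is `< T₁` and vice versa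
  have hle12 : ∀ T' : ℝ, 0 < T' → T' < T₂ → T' < T₁ ∧ ∀ t ∈ Icc 0 T', ∀ (i : Fin m) (n : ℤ),
      X₂ i n t = X₁ i n t := by
    intro T' hT'0 hT'2
    obtain ⟨M, hM⟩ := h₂r T' hT'0 hT'2
    exact maximalFlow_unique hε hν hα h₁C h₁0 h₁m h₁r h₁u hT'0 h₂0 (hwin h₂C h₂m T' hT'2)
      ⟨M, fun t ht i n => hM t ht.1 ht.2 i n⟩
  have hle21 : ∀ T' : ℝ, 0 < T' → T' < T₁ → T' < T₂ := by
    intro T' hT'0 hT'1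
    obtain ⟨M, hM⟩ := h₁r T' hT'0 hT'1
    exact (maximalFlow_unique hε hν hα h₂C h₂0 h₂m h₂r h₂u hT'0 h₁0 (hwin h₁C h₁m T' hT'1)
      ⟨M, fun t ht i n => hM t ht.1 ht.2 i n⟩).1
  have hT₁ : 0 < T₁ := by obtain ⟨t, ht0, ht1, -⟩ := h₁u 0; linarith
  have hT₂ : 0 < T₂ := by obtain ⟨t, ht0, ht2, -⟩ := h₂u 0; linarith
  have heq : T₁ = T₂ := by
    by_contra hne
    rcases lt_or_gt_of_ne hne with h | h
    · -- `T₁ < T₂`: take `T' = T₁`... any `T' ∈ (T₁, T₂)` contradicts `hle12`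
      have := (hle12 ((T₁ + T₂) / 2) (by linarith) (by linarith)).1
      linarith
    · have := hle21 ((T₁ + T₂) / 2) (by linarith) (by linarith)
      linarith
  refine ⟨heq, fun t ht0 ht1 i n => ?_⟩
  have h := (hle12 ((t + T₁) / 2) (by linarith) (by rw [← heq]; linarith)).2 t
    ⟨ht0, by linarith⟩ i n
  exact h.symm

end BlowupRigidityOne

end Summit.NavierStokesRegularity.NavierStokesRegularity.Theorems

end
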